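import Mathlib
import HarnessLib
import Summits.Ventures.LatticeQCDFlow.Scoring.SplitChainTailsPair
import Summits.Ventures.LatticeQCDFlow.Scoring.SplitResolventPoisson

/-!
# Tours of the split chain, VIII (general minorising law): two-time moments along the first tour,
# the cycle formula as a series, and the SECOND MOMENT OF THE CENTRED TOUR SUM AS A DOUBLE SERIES

HONEST FRAMING: exact (Metropolis-corrected) sampling algorithms for lattice gauge theory;
figures of merit are autocorrelation/cost numbers at stated couplings and volumes; no
continuum-physics claim.

Venture `LatticeQCDFlow` (cell pub-lqcd), topic `Scoring`; FANOUT row 8 (`s0-cpn-nemc`, GEN-17).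
NEW WORK of the cell, not a published result; no definition is introduced.  Notation of
`Scoring/SplitChainTours.lean`: the split chain `P̂` of `κ(x, ·) ≥ ε ν` for an ARBITRARY probability
law `ν`, `T_{0,u} = 1{K_u = 0}`, `R` the residual kernel, `P̂_ν̂` the fresh split chain from
`ν ⊗ δ_true`, `f̄ = f − π(f)`, `Z_0 = ∑' u, 1{K_u = 0} f̄(X_u)`.  `Scoring/TourVariance.lean` computed
`E_{P̂_π̂}[Z_0²]` when the minorising law IS the invariant law (`ν = π`, where `π R = π` collapses every
moment to a `π`-integral).  Here the same square expansion is carried out for general `ν`, keeping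
the moments as path-space expectations: (i) along the first tour the later observation moves by the
residual kernel, `E[T_{0,t+d} g₁(X_t) g₂(X_{t+d})] = (1−ε)^d E[T_{0,t} (g₁ · R^d g₂)(X_t)]` (any start);
(ii) KAC AS A SERIES: `Σ_u E_ν̂[1{K_u = 0} φ(X_u)] = π(φ)/ε` (`HasSum`); (iii) squaring the finished tour
pathwise and summing term by term (dominated by `(2C)²(2u+1)(1−ε)^u`):
`E_ν̂[Z_0²] = Σ_u ( E_ν̂[1{K_u=0} f̄(X_u)²] + 2 Σ_{t<u} (1−ε)^{u−t} E_ν̂[1{K_t=0} (f̄ · R^{u−t} f̄)(X_t)] )`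
(valid with any constant in place of `π(f)`: invariance is not used in (iii)).
`Scoring/TourVarianceGeneral.lean` sums (iii) with (ii), a rearrangement of the triangular double
series, and the resolvent of `Scoring/SplitResolventPoisson.lean`.  Printed
counterpart NAMED ONLY: the regenerative representation of the asymptotic variance (Nummelin 1984
§7; Meyn–Tweedie 1993 Thm 17.3.6; Mykland–Tierney–Yu 1995 eq. (4)) — nothing is cited as a fact.

## Content (`e = ε.toReal`; `0 < ε < 1`; `|f|, |g₁|, |g₂|, |φ| ≤` constants, measurable; `π` invariant)

* **`splitChain_tailsPair`** — any start: `E[T_{0,t+d} g₁(X_t) g₂(X_{t+d})] = (1−e)^d E[T_{0,t} g₁(X_t) (kop R)^[d] g₂ (X_t)]`;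
* **`splitChain_fresh_occupation_hasSum`** — `HasSum (u ↦ E_ν̂[1{K_u=0} φ(X_u)]) (π(φ)/e)`;
* `centred_observable_bounds` — `f̄` is measurable, `|f̄| ≤ 2C`, `π(f̄) = 0`;
* **`splitChain_fresh_sq_centredTourSum_series`** — THE DOUBLE SERIES for `E_ν̂[Z_0²]` displayed in (iii).

NOT CLAIMED here: the closed form (next file); any `ε` of a concrete sampler.
-/

noncomputable section

namespace Summit.Ventures.LatticeQCDFlow.Scoring

open MeasureTheory ProbabilityTheory Filter Finset Preorder Literature.Probability.MarkovChains
open scoped ENNReal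

/-! ### Two-time moments along the first tour, any start -/

section Moments

variable {Ω : Type*} [MeasurableSpace Ω]
  {κ : Kernel Ω Ω} [IsMarkovKernel κ] {ν : Measure Ω} [IsProbabilityMeasure ν] {ε : ℝ≥0∞}
  {hmin : ∀ x {B : Set Ω}, MeasurableSet B → ε * ν B ≤ κ x B}
  (κs : Kernel (Ω × Bool) (Ω × Bool)) [IsMarkovKernel κs]
  (μs : Measure (Ω × Bool)) [IsProbabilityMeasure μs]

/-- **Two-time moments along the first tour (any minorising law, any start)**: for bounded
measurable `g₁, g₂`, `E[T_{0,t+d} · g₁(X_t) · g₂(X_{t+d})] = (1−e)^d · E[T_{0,t} · g₁(X_t) · (R^d g₂)(X_t)]`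
— given survival to `t`, the later observation has moved `d` residual steps. -/
theorem splitChain_tailsPair (hε : ε < 1)
    (hκs : ∀ p, κs p = (ε • ν).map (fun y : Ω => (y, true))
      + ((1 - ε) • Doeblin.residualKernel κ ν ε hmin p.1).map (fun y : Ω => (y, false)))
    {g₁ g₂ : Ω → ℝ} (hg₁ : Measurable g₁) (hg₂ : Measurable g₂) {C₁ C₂ : ℝ}
    (hC₁ : ∀ y, |g₁ y| ≤ C₁) (hC₂ : ∀ y, |g₂ y| ≤ C₂) (t d : ℕ) :
    ∫ x, (∏ i ∈ Finset.range (t + d), (if (x (i + 1)).2 then (0 : ℝ) else 1))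
        * g₁ (x t).1 * g₂ (x (t + d)).1
        ∂(Kernel.trajMeasure (X := fun _ : ℕ => Ω × Bool) μs
          (fun n : ℕ => κs.comap (fun h : (i : ↥(Finset.Iic n)) → Ω × Bool =>
            h ⟨n, Finset.mem_Iic.2 le_rfl⟩) (measurable_pi_apply _)))
      = (1 - ε.toReal) ^ d * ∫ x, (∏ i ∈ Finset.range t, (if (x (i + 1)).2 then (0 : ℝ) else 1))
        * g₁ (x t).1 * (kop (Doeblin.residualKernel κ ν ε hmin))^[d] g₂ (x t).1
        ∂(Kernel.trajMeasure (X := fun _ : ℕ => Ω × Bool) μs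
          (fun n : ℕ => κs.comap (fun h : (i : ↥(Finset.Iic n)) → Ω × Bool =>
            h ⟨n, Finset.mem_Iic.2 le_rfl⟩) (measurable_pi_apply _))) := by
  set P := Kernel.trajMeasure (X := fun _ : ℕ => Ω × Bool) μs
      (fun n : ℕ => κs.comap (fun h : (i : ↥(Finset.Iic n)) → Ω × Bool =>
        h ⟨n, Finset.mem_Iic.2 le_rfl⟩) (measurable_pi_apply _)) with hP
  -- the weight `T_{0,t} · g₁(X_t)` depends on the past up to `t`
  have hGm : Measurable fun x : ℕ → Ω × Bool =>
      (∏ i ∈ Finset.range t, (if (x (i + 1)).2 then (0 : ℝ) else 1)) * g₁ (x t).1 :=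
    (measurable_tailsProd₀ t).mul (hg₁.comp (measurable_fst.comp (measurable_pi_apply t)))
  have hGd : DependsOn (fun x : ℕ → Ω × Bool =>
      (∏ i ∈ Finset.range t, (if (x (i + 1)).2 then (0 : ℝ) else 1)) * g₁ (x t).1) (Set.Iic t) := by
    intro x y hxy
    show _ * _ = _ * _
    rw [hxy t (Set.mem_Iic.2 le_rfl)]
    congr 1
    exact Finset.prod_congr rfl fun i hi => by
      rw [hxy (i + 1) (Set.mem_Iic.2 (by have := Finset.mem_range.1 hi; omega))]
  have hGC : ∀ x : ℕ → Ω × Bool,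
      |(∏ i ∈ Finset.range t, (if (x (i + 1)).2 then (0 : ℝ) else 1)) * g₁ (x t).1| ≤ C₁ := fun x => by
    rw [abs_mul, abs_of_nonneg (tailsProd₀_mem t x).1]
    calc _ ≤ 1 * |g₁ (x t).1| := mul_le_mul_of_nonneg_right (tailsProd₀_mem t x).2 (abs_nonneg _)
      _ ≤ C₁ := by rw [one_mul]; exact hC₁ _
  have step := splitChain_tailsRun_move κs μs (κ := κ) (ν := ν) (hmin := hmin) hε hκs t hGm hGd hGC
    d hg₂ hC₂
  rw [← hP] at step
  calc ∫ x, (∏ i ∈ Finset.range (t + d), (if (x (i + 1)).2 then (0 : ℝ) else 1))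
        * g₁ (x t).1 * g₂ (x (t + d)).1 ∂P
      = ∫ x, (∏ i ∈ Finset.range t, (if (x (i + 1)).2 then (0 : ℝ) else 1)) * g₁ (x t).1
          * (∏ i ∈ Finset.range d, (if (x (t + i + 1)).2 then (0 : ℝ) else 1))
          * g₂ (x (t + d)).1 ∂P := integral_congr_ae (ae_of_all _ fun x => by
            beta_reduce; rw [tailsProd₀_add]; ring)
    _ = _ := step

/-- **KAC AS A SERIES (fresh start)**: for `π` invariant, `0 < ε < 1` and bounded measurable `φ`,
`HasSum (u ↦ E_ν̂[1{K_u = 0} φ(X_u)]) (π(φ)/e)` — summing the expected occupation of `φ` over the first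
tour, time slice by time slice, gives the stationary mean over `ε`. -/
theorem splitChain_fresh_occupation_hasSum {π : Measure Ω} [IsProbabilityMeasure π]
    (hπ : Kernel.Invariant κ π) (hε0 : 0 < ε) (hε : ε < 1)
    (hκs : ∀ p, κs p = (ε • ν).map (fun y : Ω => (y, true))
      + ((1 - ε) • Doeblin.residualKernel κ ν ε hmin p.1).map (fun y : Ω => (y, false)))
    {φ : Ω → ℝ} (hφ : Measurable φ) {Cφ : ℝ} (hCφ : ∀ x, |φ x| ≤ Cφ) :
    HasSum (fun u : ℕ => ∫ x, (if (∑ s ∈ Finset.range u, (if (x (s + 1)).2 then (1 : ℕ) else 0)) = 0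
        then (1 : ℝ) else 0) * φ (x u).1
        ∂(Kernel.trajMeasure (X := fun _ : ℕ => Ω × Bool) (ν.map (fun y : Ω => (y, true)))
          (fun n : ℕ => κs.comap (fun h : (i : ↥(Finset.Iic n)) → Ω × Bool =>
            h ⟨n, Finset.mem_Iic.2 le_rfl⟩) (measurable_pi_apply _))))
      ((∫ x, φ x ∂π) / ε.toReal) := by
  haveI hνt : IsProbabilityMeasure (ν.map (fun y : Ω => (y, true))) :=
    Measure.isProbabilityMeasure_map (measurable_tagCoin true).aemeasurable
  have hterm : ∀ u, ∫ x, (if (∑ s ∈ Finset.range u, (if (x (s + 1)).2 then (1 : ℕ) else 0)) = 0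
      then (1 : ℝ) else 0) * φ (x u).1
      ∂(Kernel.trajMeasure (X := fun _ : ℕ => Ω × Bool) (ν.map (fun y : Ω => (y, true)))
        (fun n : ℕ => κs.comap (fun h : (i : ↥(Finset.Iic n)) → Ω × Bool =>
          h ⟨n, Finset.mem_Iic.2 le_rfl⟩) (measurable_pi_apply _)))
      = (1 - ε.toReal) ^ u * ∫ y, (kop (Doeblin.residualKernel κ ν ε hmin))^[u] φ y ∂ν := by
    intro u
    simp_rw [headCount_eq_zero_indicator]
    exact splitChain_fresh_tailsRun_move κs (κ := κ) (ν := ν) (hmin := hmin) hε hκs hφ hCφ u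
  simp_rw [hterm]
  exact doeblin_series_hasSum (κ := κ) (ν := ν) (hmin := hmin) hπ hε0 hε hφ hCφ

/-- Bookkeeping for the centred observable `f̄ = f − π(f)`: measurable, `|f̄| ≤ 2C`, `π(f̄) = 0`. -/
theorem centred_observable_bounds (π : Measure Ω) [IsProbabilityMeasure π] {f : Ω → ℝ}
    (hf : Measurable f) {C : ℝ} (hC : ∀ x, |f x| ≤ C) :
    Measurable (fun y => f y - ∫ z, f z ∂π) ∧ (∀ y, |f y - ∫ z, f z ∂π| ≤ 2 * C)
      ∧ ∫ y, (f y - ∫ z, f z ∂π) ∂π = 0 := by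
  have hcC : |∫ z, f z ∂π| ≤ C := by
    calc |∫ z, f z ∂π| = ‖∫ z, f z ∂π‖ := (Real.norm_eq_abs _).symm
      _ ≤ C * π.real Set.univ := norm_integral_le_of_norm_le_const (Eventually.of_forall fun y => by
          rw [Real.norm_eq_abs]; exact hC y)
      _ = C := by rw [probReal_univ, mul_one]
  refine ⟨hf.sub_const _, fun y => ?_, ?_⟩
  · calc |f y - ∫ z, f z ∂π| ≤ |f y| + |∫ z, f z ∂π| := abs_sub _ _
      _ ≤ C + C := add_le_add (hC y) hcC
      _ = 2 * C := by ring
  · rw [integral_sub (integrable_of_bounded π hf hC) (integrable_const _), integral_const,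
      probReal_univ, one_smul, sub_self]

/-- **THE SECOND MOMENT OF THE CENTRED TOUR SUM AS A DOUBLE SERIES (general minorising law).**
`κ(x, ·) ≥ ε ν`, `0 < ε < 1`, `|f| ≤ C` measurable, `f̄ = f − π(f)` for any probability law `π`
(invariance is not needed here); under the fresh split chain from `ν ⊗ δ_true`:
`E[Z_0²] = ∑' u, ( E[1{K_u=0} f̄(X_u)²] + 2 Σ_{t<u} (1−e)^{u−t} E[1{K_t=0} f̄(X_t) · ((kop R)^[u−t] f̄)(X_t)] )`. -/
theorem splitChain_fresh_sq_centredTourSum_series {π : Measure Ω} [IsProbabilityMeasure π]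
    (hε0 : 0 < ε) (hε : ε < 1)
    (hκs : ∀ p, κs p = (ε • ν).map (fun y : Ω => (y, true))
      + ((1 - ε) • Doeblin.residualKernel κ ν ε hmin p.1).map (fun y : Ω => (y, false)))
    {f : Ω → ℝ} (hf : Measurable f) {C : ℝ} (hC : ∀ x, |f x| ≤ C) :
    ∫ x, (∑' u, (if (∑ s ∈ Finset.range u, (if (x (s + 1)).2 then (1 : ℕ) else 0)) = 0
        then (1 : ℝ) else 0) * (f (x u).1 - ∫ z, f z ∂π)) ^ 2
        ∂(Kernel.trajMeasure (X := fun _ : ℕ => Ω × Bool) (ν.map (fun y : Ω => (y, true)))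
          (fun n : ℕ => κs.comap (fun h : (i : ↥(Finset.Iic n)) → Ω × Bool =>
            h ⟨n, Finset.mem_Iic.2 le_rfl⟩) (measurable_pi_apply _)))
      = ∑' u, ((∫ x, (if (∑ s ∈ Finset.range u, (if (x (s + 1)).2 then (1 : ℕ) else 0)) = 0
          then (1 : ℝ) else 0) * (f (x u).1 - ∫ z, f z ∂π) ^ 2
          ∂(Kernel.trajMeasure (X := fun _ : ℕ => Ω × Bool) (ν.map (fun y : Ω => (y, true)))
            (fun n : ℕ => κs.comap (fun h : (i : ↥(Finset.Iic n)) → Ω × Bool =>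
              h ⟨n, Finset.mem_Iic.2 le_rfl⟩) (measurable_pi_apply _))))
        + 2 * ∑ t ∈ Finset.range u, (1 - ε.toReal) ^ (u - t)
          * ∫ x, (if (∑ s ∈ Finset.range t, (if (x (s + 1)).2 then (1 : ℕ) else 0)) = 0
            then (1 : ℝ) else 0) * ((f (x t).1 - ∫ z, f z ∂π)
              * (kop (Doeblin.residualKernel κ ν ε hmin))^[u - t] (fun y => f y - ∫ z, f z ∂π) (x t).1)
          ∂(Kernel.trajMeasure (X := fun _ : ℕ => Ω × Bool) (ν.map (fun y : Ω => (y, true)))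
            (fun n : ℕ => κs.comap (fun h : (i : ↥(Finset.Iic n)) → Ω × Bool =>
              h ⟨n, Finset.mem_Iic.2 le_rfl⟩) (measurable_pi_apply _)))) := by
  haveI hνt : IsProbabilityMeasure (ν.map (fun y : Ω => (y, true))) :=
    Measure.isProbabilityMeasure_map (measurable_tagCoin true).aemeasurable
  haveI := Doeblin.isMarkovKernel_residualKernel (κ := κ) (ν := ν) (hmin := hmin) hε
  obtain ⟨hfb, hCfb, -⟩ := centred_observable_bounds π hf hC
  set P := Kernel.trajMeasure (X := fun _ : ℕ => Ω × Bool) (ν.map (fun y : Ω => (y, true)))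
      (fun n : ℕ => κs.comap (fun h : (i : ↥(Finset.Iic n)) → Ω × Bool =>
        h ⟨n, Finset.mem_Iic.2 le_rfl⟩) (measurable_pi_apply _)) with hP
  set c := ∫ z, f z ∂π with hc
  set fb : Ω → ℝ := fun y => f y - c with hfbdef
  set r : ℝ := 1 - ε.toReal with hrdef
  obtain ⟨-, hr0, he1⟩ := one_sub_toReal_eq_of_lt_one (ε := ε) hε
  rw [← hrdef] at hr0
  have he0 : 0 < ε.toReal := ENNReal.toReal_pos hε0.ne' (ne_top_of_lt hε)
  have hr1 : r < 1 := by rw [hrdef]; linarith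
  have hrnorm : ‖r‖ < 1 := by rw [Real.norm_eq_abs, abs_of_nonneg hr0]; exact hr1
  have hC0 : 0 ≤ C := (abs_nonneg _).trans (hC (Classical.choice (nonempty_of_isProbabilityMeasure π)))
  have hRd := fun d => iterate_kop_bounded_measurable (Doeblin.residualKernel κ ν ε hmin) hfb hCfb d
  -- (2) the moments of the series terms
  have hG : ∀ u : ℕ, ∫ x, (∏ i ∈ Finset.range u, (if (x (i + 1)).2 then (0 : ℝ) else 1))
      * (fb (x u).1 * (fb (x u).1 + 2 * ∑ t ∈ Finset.range u, fb (x t).1)) ∂P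
      = (∫ x, (∏ i ∈ Finset.range u, (if (x (i + 1)).2 then (0 : ℝ) else 1)) * fb (x u).1 ^ 2 ∂P)
        + 2 * ∑ t ∈ Finset.range u, r ^ (u - t)
          * ∫ x, (∏ i ∈ Finset.range t, (if (x (i + 1)).2 then (0 : ℝ) else 1))
            * (fb (x t).1 * (kop (Doeblin.residualKernel κ ν ε hmin))^[u - t] fb (x t).1) ∂P := by
    intro u
    -- off-diagonal terms
    have hoff : ∀ t ∈ Finset.range u, ∫ x, (∏ i ∈ Finset.range u,
        (if (x (i + 1)).2 then (0 : ℝ) else 1)) * fb (x t).1 * fb (x u).1 ∂P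
        = r ^ (u - t) * ∫ x, (∏ i ∈ Finset.range t, (if (x (i + 1)).2 then (0 : ℝ) else 1))
            * (fb (x t).1 * (kop (Doeblin.residualKernel κ ν ε hmin))^[u - t] fb (x t).1) ∂P := by
      intro t ht
      have htu : t + (u - t) = u := by have := Finset.mem_range.1 ht; omega
      have h := splitChain_tailsPair κs (ν.map (fun y : Ω => (y, true))) (κ := κ) (ν := ν)
        (hmin := hmin) hε hκs hfb hfb hCfb hCfb t (u - t)
      rw [htu, ← hP] at h
      rw [h, hrdef]
      congr 1
      exact integral_congr_ae (ae_of_all _ fun x => by ring)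
    -- integrability of the pieces
    have hTm := measurable_tailsProd₀ (Ω := Ω) u
    have hfbu : ∀ v : ℕ, Measurable fun x : ℕ → Ω × Bool => fb (x v).1 := fun v =>
      hfb.comp (measurable_fst.comp (measurable_pi_apply v))
    have hI1 : Integrable (fun x : ℕ → Ω × Bool => (∏ i ∈ Finset.range u,
        (if (x (i + 1)).2 then (0 : ℝ) else 1)) * fb (x u).1 ^ 2) P := by
      refine integrable_of_bounded P (hTm.mul ((hfbu u).pow_const 2)) (C := 1 * (2 * C) ^ 2)
        fun x => ?_
      rw [abs_mul, abs_of_nonneg (tailsProd₀_mem u x).1, abs_pow]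
      exact mul_le_mul (tailsProd₀_mem u x).2 (pow_le_pow_left₀ (abs_nonneg _) (hCfb _) 2)
        (by positivity) zero_le_one
    have hI2 : ∀ t ∈ Finset.range u, Integrable (fun x : ℕ → Ω × Bool => (∏ i ∈ Finset.range u,
        (if (x (i + 1)).2 then (0 : ℝ) else 1)) * fb (x t).1 * fb (x u).1) P := by
      intro t _
      refine integrable_of_bounded P ((hTm.mul (hfbu t)).mul (hfbu u)) (C := 1 * (2 * C) * (2 * C))
        fun x => ?_
      rw [abs_mul, abs_mul, abs_of_nonneg (tailsProd₀_mem u x).1]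
      exact mul_le_mul (mul_le_mul (tailsProd₀_mem u x).2 (hCfb _) (abs_nonneg _) zero_le_one)
        (hCfb _) (abs_nonneg _) (by positivity)
    have hsplit : ∀ x : ℕ → Ω × Bool, (∏ i ∈ Finset.range u, (if (x (i + 1)).2 then (0 : ℝ) else 1))
        * (fb (x u).1 * (fb (x u).1 + 2 * ∑ t ∈ Finset.range u, fb (x t).1))
        = (∏ i ∈ Finset.range u, (if (x (i + 1)).2 then (0 : ℝ) else 1)) * fb (x u).1 ^ 2
          + 2 * ∑ t ∈ Finset.range u, (∏ i ∈ Finset.range u,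
            (if (x (i + 1)).2 then (0 : ℝ) else 1)) * fb (x t).1 * fb (x u).1 := by
      intro x
      set T := ∏ i ∈ Finset.range u, (if (x (i + 1)).2 then (0 : ℝ) else 1) with hT
      calc T * (fb (x u).1 * (fb (x u).1 + 2 * ∑ t ∈ Finset.range u, fb (x t).1))
          = T * fb (x u).1 ^ 2
            + 2 * ((T * fb (x u).1) * ∑ t ∈ Finset.range u, fb (x t).1) := by ring
        _ = T * fb (x u).1 ^ 2
            + 2 * ∑ t ∈ Finset.range u, (T * fb (x u).1) * fb (x t).1 := by rw [Finset.mul_sum]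
        _ = _ := by
            congr 1
            congr 1
            exact Finset.sum_congr rfl fun t _ => by ring
    simp_rw [hsplit]
    rw [integral_add hI1 ((integrable_finsetSum _ hI2).const_mul 2), integral_const_mul,
      integral_finsetSum _ hI2, Finset.sum_congr rfl hoff]
  -- the indicator form of (2)
  have hG' : ∀ u : ℕ, ∫ x, (if (∑ s ∈ Finset.range u, (if (x (s + 1)).2 then (1 : ℕ) else 0)) = 0
      then (1 : ℝ) else 0) * (fb (x u).1 * (fb (x u).1 + 2 * ∑ t ∈ Finset.range u, fb (x t).1)) ∂P
      = (∫ x, (if (∑ s ∈ Finset.range u, (if (x (s + 1)).2 then (1 : ℕ) else 0)) = 0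
          then (1 : ℝ) else 0) * fb (x u).1 ^ 2 ∂P)
        + 2 * ∑ t ∈ Finset.range u, r ^ (u - t)
          * ∫ x, (if (∑ s ∈ Finset.range t, (if (x (s + 1)).2 then (1 : ℕ) else 0)) = 0
            then (1 : ℝ) else 0)
            * (fb (x t).1 * (kop (Doeblin.residualKernel κ ν ε hmin))^[u - t] fb (x t).1) ∂P :=
    fun u => by simp_rw [headCount_eq_zero_indicator]; exact hG u
  -- (3) integrability of the series terms and summability of their norms
  have hfbu : ∀ v : ℕ, Measurable fun x : ℕ → Ω × Bool => fb (x v).1 := fun v =>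
    hfb.comp (measurable_fst.comp (measurable_pi_apply v))
  have hGm : ∀ u : ℕ, Measurable fun x : ℕ → Ω × Bool => (if (∑ s ∈ Finset.range u,
      (if (x (s + 1)).2 then (1 : ℕ) else 0)) = 0 then (1 : ℝ) else 0)
      * (fb (x u).1 * (fb (x u).1 + 2 * ∑ t ∈ Finset.range u, fb (x t).1)) := fun u =>
    (measurable_headCountIndicator u 0).mul ((hfbu u).mul ((hfbu u).add
      ((Finset.measurable_sum _ fun t _ => hfbu t).const_mul 2)))
  have hGbd : ∀ (u : ℕ) (x : ℕ → Ω × Bool), |(if (∑ s ∈ Finset.range u,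
      (if (x (s + 1)).2 then (1 : ℕ) else 0)) = 0 then (1 : ℝ) else 0)
      * (fb (x u).1 * (fb (x u).1 + 2 * ∑ t ∈ Finset.range u, fb (x t).1))|
      ≤ (2 * C) ^ 2 * (2 * (u : ℝ) + 1) * (if (∑ s ∈ Finset.range u,
        (if (x (s + 1)).2 then (1 : ℕ) else 0)) = 0 then (1 : ℝ) else 0) := by
    intro u x
    have hind : 0 ≤ (if (∑ s ∈ Finset.range u, (if (x (s + 1)).2 then (1 : ℕ) else 0)) = 0
        then (1 : ℝ) else 0) := by split_ifs <;> norm_num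
    have hsum : |∑ t ∈ Finset.range u, fb (x t).1| ≤ u * (2 * C) := by
      calc |∑ t ∈ Finset.range u, fb (x t).1| ≤ ∑ t ∈ Finset.range u, |fb (x t).1| :=
            Finset.abs_sum_le_sum_abs _ _
        _ ≤ ∑ _t ∈ Finset.range u, 2 * C := Finset.sum_le_sum fun t _ => hCfb _
        _ = u * (2 * C) := by rw [Finset.sum_const, Finset.card_range, nsmul_eq_mul]
    have h2 : |fb (x u).1 + 2 * ∑ t ∈ Finset.range u, fb (x t).1| ≤ 2 * C + 2 * (u * (2 * C)) := by
      calc _ ≤ |fb (x u).1| + |2 * ∑ t ∈ Finset.range u, fb (x t).1| := abs_add_le _ _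
        _ ≤ 2 * C + 2 * (u * (2 * C)) := by
            rw [abs_mul, abs_two]; exact add_le_add (hCfb _) (mul_le_mul_of_nonneg_left hsum zero_le_two)
    rw [abs_mul, abs_of_nonneg hind, mul_comm]
    refine mul_le_mul_of_nonneg_right ?_ hind
    rw [abs_mul]
    calc |fb (x u).1| * |fb (x u).1 + 2 * ∑ t ∈ Finset.range u, fb (x t).1|
        ≤ (2 * C) * (2 * C + 2 * (u * (2 * C))) := mul_le_mul (hCfb _) h2 (abs_nonneg _) (by positivity)
      _ = (2 * C) ^ 2 * (2 * (u : ℝ) + 1) := by ring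
  have hTint : ∀ u : ℕ, ∫ x, (if (∑ s ∈ Finset.range u, (if (x (s + 1)).2 then (1 : ℕ) else 0)) = 0
      then (1 : ℝ) else 0) ∂P = r ^ u := fun u => by
    simp_rw [headCount_eq_zero_indicator]
    rw [hP]; exact splitChain_fresh_tailsRun κs (κ := κ) (ν := ν) (hmin := hmin) hε hκs u
  have hGint : ∀ u : ℕ, Integrable (fun x : ℕ → Ω × Bool => (if (∑ s ∈ Finset.range u,
      (if (x (s + 1)).2 then (1 : ℕ) else 0)) = 0 then (1 : ℝ) else 0)
      * (fb (x u).1 * (fb (x u).1 + 2 * ∑ t ∈ Finset.range u, fb (x t).1))) P := fun u =>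
    integrable_of_bounded P (hGm u) (C := (2 * C) ^ 2 * (2 * (u : ℝ) + 1) * 1) fun x =>
      (hGbd u x).trans (mul_le_mul_of_nonneg_left (by split_ifs <;> norm_num) (by positivity))
  have hnorm : ∀ u : ℕ, ∫ x, ‖(if (∑ s ∈ Finset.range u, (if (x (s + 1)).2 then (1 : ℕ) else 0)) = 0
      then (1 : ℝ) else 0) * (fb (x u).1 * (fb (x u).1 + 2 * ∑ t ∈ Finset.range u, fb (x t).1))‖ ∂P
      ≤ (2 * C) ^ 2 * (2 * (u : ℝ) + 1) * r ^ u := by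
    intro u
    rw [← hTint u, ← integral_const_mul]
    refine integral_mono (hGint u).norm ((integrable_of_bounded P (measurable_headCountIndicator u 0)
      (C := 1) fun x => by split_ifs <;> simp).const_mul _) fun x => ?_
    rw [Real.norm_eq_abs]
    exact hGbd u x
  have hS1 : HasSum (fun u : ℕ => (u : ℝ) * r ^ u) (r / (1 - r) ^ 2) :=
    hasSum_coe_mul_geometric_of_norm_lt_one hrnorm
  have hS2 : HasSum (fun u : ℕ => r ^ u) (1 - r)⁻¹ := hasSum_geometric_of_lt_one hr0 hr1
  have hSmaj : Summable fun u : ℕ => (2 * C) ^ 2 * (2 * (u : ℝ) + 1) * r ^ u := by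
    have h := ((hS1.mul_left 2).add hS2).mul_left ((2 * C) ^ 2)
    refine h.summable.congr fun u => ?_
    ring
  have hsumG : Summable fun u : ℕ => ∫ x, ‖(if (∑ s ∈ Finset.range u,
      (if (x (s + 1)).2 then (1 : ℕ) else 0)) = 0 then (1 : ℝ) else 0)
      * (fb (x u).1 * (fb (x u).1 + 2 * ∑ t ∈ Finset.range u, fb (x t).1))‖ ∂P :=
    Summable.of_nonneg_of_le (fun u => integral_nonneg fun x => norm_nonneg _) hnorm hSmaj
  -- (1) almost surely `Z_0² = ∑' G_u`
  have hae : ∀ᵐ x ∂P, (∑' u, (if (∑ s ∈ Finset.range u, (if (x (s + 1)).2 then (1 : ℕ) else 0)) = 0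
      then (1 : ℝ) else 0) * (f (x u).1 - c)) ^ 2
      = ∑' u, (if (∑ s ∈ Finset.range u, (if (x (s + 1)).2 then (1 : ℕ) else 0)) = 0
        then (1 : ℝ) else 0) * (fb (x u).1 * (fb (x u).1 + 2 * ∑ t ∈ Finset.range u, fb (x t).1)) := by
    have h := splitChain_ae_tourStart κs (ν.map (fun y : Ω => (y, true))) (κ := κ) (ν := ν)
      (hmin := hmin) hε0 hε hκs
    rw [← hP] at h
    filter_upwards [h] with x hx
    obtain ⟨t₀, ht₀, hh₀⟩ := hx 0
    exact sq_tourSum_zero_eq_tsum fb x ht₀ hh₀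
  -- (4) assemble
  rw [integral_congr_ae hae, ← integral_tsum_of_summable_integral_norm hGint hsumG]
  exact tsum_congr fun u => hG' u

end Moments

end Summit.Ventures.LatticeQCDFlow.Scoring

end
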